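import Summits.QuantumFields.YangMills.Theorems.VirialFluxGapFixHtubePhasePackage
import Summits.QuantumFields.YangMills.Theorems.VirialFluxGapFixCoordPhasePackageBounds
import HarnessLib

/-!
# ★★★ The per-tube estimate on `X_fix` for the actual phase — FINAL FORM (critical value discharged, spectral window exported)
# (layers (B2)+(B3) of the DIRECT Laplace road to ⟨stmt-QuantumFields-24204⟩ `VirialFluxGap.SharpTwistedLaplace`)

Helper module (free-hands work of width seat ym-line-sfw-p2-w3 g57, cell ym-idea-1; `--supports 24204`).  Same glue as
✓`fix_htube_of_phasePackage'` but fed by ✓`AnchorSlice.exists_phase_package_fixCoord'` (w2 g50, …FixCoordPhasePackageBounds), which also proves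
the CRITICAL VALUE `F_fix(σ_s 0) = 0` and the upper bound `⟪Av,v⟫ ≤ 384L⁴‖v‖²`:
* ★★★ `fix_htube_of_phasePackage''` — hypothesis `hF0` dropped; conclusion exports `spec A ⊂ [2·10⁻²²L⁻³³, 384L⁴]` (for ✓`abs_log_orbitCoeff_le`).
Everything here is PROVED; no definitions, no named facts.  HONEST FRAMING: CONDITIONAL assembly step; ⟨24204⟩, ⟨24319⟩ and every rung stay OPEN;
the Yang–Mills mass gap (Clay) is NOT touched; no summit is proved by a line.

## References
* K. W. Breitung, *Asymptotic Approximations for Probability Integrals*, LNM 1592 (1994), Thm 41 p. 56; §2.3. [Breitung1994]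
-/

set_option autoImplicit false

noncomputable section

open MeasureTheory Set Filter Metric WithLp Module
open scoped ENNReal RealInnerProductSpace Pointwise Quaternion
open Literature.MathematicalPhysics.QuantumLattice
open Literature.MathematicalPhysics.QuantumFieldTheory hiding SU2 su2Quat_mul
open Literature.MathematicalPhysics.QuantumFieldTheory.Balaban1983to89
open Literature.MathematicalPhysics.QuantumFieldTheory.Balaban1983to89.T4HaarSU2ExpChart
open Summit.QuantumFields.YangMills.Theorems.FemtoTransferGap
open Summit.QuantumFields.YangMills.Theorems.FemtoTransferGap.TT
open Summit.QuantumFields.YangMills.Theorems.FemtoTransferGap.TwoLattice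
open Summit.QuantumFields.YangMills.Theorems.FemtoTransferGap.TwoLattice.Flat
open Summit.QuantumFields.YangMills.Theorems.VirialFluxGap.AnchorSlice
open Summit.QuantumFields.YangMills.Theorems.VirialFluxGap.RingDeficit
open Summit.QuantumFields.YangMills.Theorems.QuantitativeLaplace

namespace Summit.QuantumFields.YangMills.Theorems.VirialFluxGap.FixSplit

/-- ★★★ **THE PER-TUBE ESTIMATE FOR THE ACTUAL PHASE, FINAL FORM**: as `fix_htube_of_phasePackage'` but fed by
✓`exists_phase_package_fixCoord'` (w2 g50), so the critical value `F_fix(σ_s 0) = 0` is DISCHARGED and the upper spectral bound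
`⟪Av,v⟫ ≤ 384L⁴‖v‖²` is exported (input of ✓`abs_log_orbitCoeff_le`). [cite: Breitung1994, Thm 41 p. 56] -/
theorem fix_htube_of_phasePackage'' {ωC ωN ωX : EuclideanSpace ℝ (Fin 3)} {C₀ N₀ : SU2} (hC : ‖ωC‖ = 1) (hN : ‖ωN‖ = 1)
    (hCN : ⟪ωC, ωN⟫ = 0) (hX : imQuat ωX = imQuat ωC * imQuat ωN) (hC₀ : su2Quat C₀ = imQuat ωC) (hN₀ : su2Quat N₀ = imQuat ωN) :
    ∃ r₀ : ℝ, ∃ D G A₀ cν : Bool → ℝ, 0 < r₀ ∧ r₀ < 1 ∧ (∀ b, 0 ≤ D b) ∧ (∀ b, 0 ≤ G b) ∧ (∀ b, 0 < A₀ b) ∧ (∀ b, 0 < cν b) ∧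
      ∀ (L : ℕ) [NeZero L] (hL : 2 ≤ L) (z : Fin 3 → Bool) (hz : z ≠ fun _ => false) (k₀ : Fin 3) (hk₀ : z k₀ = true)
        (lam : Site 3 L → SU2) (hlamc : ∀ x, lam x ∈ Subgroup.center SU2) (hlam0 : lam 0 = 1)
        (hlamflip : ∀ (x : Site 3 L) (k : Fin 3), (x k = 0 ∨ x k = -1) → lam (x.shift k) = lam x * centreElem (z k))
        (hlamstay : ∀ (x : Site 3 L) (k : Fin 3), x k ≠ 0 → x k ≠ -1 → lam (x.shift k) = lam x)
        (hNre : (su2Quat N₀).re = 0) (hCre : (su2Quat C₀).re = 0)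
        (hNC : (su2Quat N₀).imI * (su2Quat C₀).imI + (su2Quat N₀).imJ * (su2Quat C₀).imJ + (su2Quat N₀).imK * (su2Quat C₀).imK = 0)
        (s : Fin 3 → Bool) (Rb : FixRest L ⟨(((fun _ => (-1 : ZMod L)), k₀) : Edge 3 L), not_treeEdge_wrap hL k₀⟩ 0)
        (hR1 : ∀ i, Rb.1 i = combFlat (fun a => centreElem (s a) * (if z a then N₀ else 1)) i.1.1)
        (hR2 : ∀ j e, Rb.2.1 j e = combFlat (fun a => centreElem (s a) * (if z a then N₀ else 1)) e)
        (hR3 : ∀ x, Rb.2.2 x = lam x.1 * C₀),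
        ∃ A : EuclideanSpace ℝ (Fin (fixDim L ⟨(((fun _ => (-1 : ZMod L)), k₀) : Edge 3 L), not_treeEdge_wrap hL k₀⟩ 0)) →ₗ[ℝ] EuclideanSpace ℝ (Fin (fixDim L ⟨(((fun _ => (-1 : ZMod L)), k₀) : Edge 3 L), not_treeEdge_wrap hL k₀⟩ 0)),
          A.IsSymmetric ∧ (∀ v, (2 / (10 ^ 22 * (L : ℝ) ^ 33)) * ‖v‖ ^ 2 ≤ ⟪A v, v⟫) ∧ (∀ v, ⟪A v, v⟫ ≤ 384 * (L : ℝ) ^ 4 * ‖v‖ ^ 2) ∧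
          0 < (A₀ (s k₀) * (2 * Real.pi ^ 2)⁻¹ ^ Fintype.card ({i : OffIdx L // ¬ i = ⟨(((fun _ => (-1 : ZMod L)), k₀) : Edge 3 L), not_treeEdge_wrap hL k₀⟩} ⊕ ((Fin (2 * L - 1) × Edge 3 L) ⊕ {y : Site 3 L // ¬ y = (0 : Site 3 L)})) / cν (s k₀) /
            Real.sqrt (LinearMap.det A)) ∧
          ∀ (β R : ℝ), 0 < β → 0 < R → R ≤ r₀ → R ≤ 1 / (10 ^ 7 * (L : ℝ) ^ 11) →
            (288 * (L : ℝ) ^ 4 * Real.sqrt 2 ^ 3 + 26880 * (L : ℝ) ^ 4 * (1 / (10 ^ 7 * (L : ℝ) ^ 11))) * R + (26880 * (L : ℝ) ^ 4) * R ^ 2 ≤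
              (2 / (10 ^ 22 * (L : ℝ) ^ 33)) / (8 * (18 * (L : ℝ) ^ 4 + 8)) →
            D (s k₀) * R ≤ 1 → G (s k₀) * R ^ 2 ≤ 1 →
          IntegrableOn (fun x : (OffIdx L → SU2) × ((Fin (2 * L - 1) → GaugeConfig 3 L SU2) × (Site 3 L → SU2)) =>
              Real.exp (-(β * ringDeficit L z ((Fin.cons (glue x.1) x.2.1 : Fin (2 * L - 1 + 1) → GaugeConfig 3 L SU2), x.2.2))))
            ((fun q : SU2 × EuclideanSpace ℝ (Fin (fixDim L ⟨(((fun _ => (-1 : ZMod L)), k₀) : Edge 3 L), not_treeEdge_wrap hL k₀⟩ 0)) =>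
            (((fun i => q.1 * (fixSlice ωC ωN ωX C₀ (centreElem (s k₀) * N₀) Rb (fixCoord q.2)).1 i * q.1⁻¹),
              ((fun j => gaugeTransform (fun _ : Site 3 L => q.1) ((fixSlice ωC ωN ωX C₀ (centreElem (s k₀) * N₀) Rb (fixCoord q.2)).2.1 j)),
                (fun x => q.1 * (fixSlice ωC ωN ωX C₀ (centreElem (s k₀) * N₀) Rb (fixCoord q.2)).2.2 x * q.1⁻¹))) : (OffIdx L → SU2) × ((Fin (2 * L - 1) → GaugeConfig 3 L SU2) × (Site 3 L → SU2)))) ''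
            ((univ : Set SU2) ×ˢ closedBall (0 : EuclideanSpace ℝ (Fin (fixDim L ⟨(((fun _ => (-1 : ZMod L)), k₀) : Edge 3 L), not_treeEdge_wrap hL k₀⟩ 0))) R))
            ((Measure.pi fun _ : OffIdx L => haarProbability SU2).prod
            ((Measure.pi fun _ : Fin (2 * L - 1) => configMeasure SU2 L).prod (gaugeMeasure L))) ∧
          |(∫ x, Real.exp (-(β * ringDeficit L z ((Fin.cons (glue x.1) x.2.1 : Fin (2 * L - 1 + 1) → GaugeConfig 3 L SU2), x.2.2)))
              ∂(((Measure.pi fun _ : OffIdx L => haarProbability SU2).prod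
            ((Measure.pi fun _ : Fin (2 * L - 1) => configMeasure SU2 L).prod (gaugeMeasure L))).restrict
                ((fun q : SU2 × EuclideanSpace ℝ (Fin (fixDim L ⟨(((fun _ => (-1 : ZMod L)), k₀) : Edge 3 L), not_treeEdge_wrap hL k₀⟩ 0)) =>
            (((fun i => q.1 * (fixSlice ωC ωN ωX C₀ (centreElem (s k₀) * N₀) Rb (fixCoord q.2)).1 i * q.1⁻¹),
              ((fun j => gaugeTransform (fun _ : Site 3 L => q.1) ((fixSlice ωC ωN ωX C₀ (centreElem (s k₀) * N₀) Rb (fixCoord q.2)).2.1 j)),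
                (fun x => q.1 * (fixSlice ωC ωN ωX C₀ (centreElem (s k₀) * N₀) Rb (fixCoord q.2)).2.2 x * q.1⁻¹))) : (OffIdx L → SU2) × ((Fin (2 * L - 1) → GaugeConfig 3 L SU2) × (Site 3 L → SU2)))) ''
            ((univ : Set SU2) ×ˢ closedBall (0 : EuclideanSpace ℝ (Fin (fixDim L ⟨(((fun _ => (-1 : ZMod L)), k₀) : Edge 3 L), not_treeEdge_wrap hL k₀⟩ 0))) R)))) -
            (A₀ (s k₀) * (2 * Real.pi ^ 2)⁻¹ ^ Fintype.card ({i : OffIdx L // ¬ i = ⟨(((fun _ => (-1 : ZMod L)), k₀) : Edge 3 L), not_treeEdge_wrap hL k₀⟩} ⊕ ((Fin (2 * L - 1) × Edge 3 L) ⊕ {y : Site 3 L // ¬ y = (0 : Site 3 L)})) / cν (s k₀) /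
            Real.sqrt (LinearMap.det A)) * (2 * Real.pi / β) ^ ((9 : ℝ) * (L : ℝ) ^ 4)| ≤
            (16 * (18 * (L : ℝ) ^ 4 + 8) / ((2 / (10 ^ 22 * (L : ℝ) ^ 33)) * R ^ 2) +
              16 * G (s k₀) * (18 * (L : ℝ) ^ 4 + 8) / (2 / (10 ^ 22 * (L : ℝ) ^ 33)) +
            256 * ((26880 * (L : ℝ) ^ 4) + ((288 * (L : ℝ) ^ 4 * Real.sqrt 2 ^ 3 + 26880 * (L : ℝ) ^ 4 * (1 / (10 ^ 7 * (L : ℝ) ^ 11))) + (26880 * (L : ℝ) ^ 4) * R) * (D (s k₀) + G (s k₀) * R)) * (18 * (L : ℝ) ^ 4 + 8) ^ 2 / (2 / (10 ^ 22 * (L : ℝ) ^ 33)) ^ 2 +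
            18432 * ((288 * (L : ℝ) ^ 4 * Real.sqrt 2 ^ 3 + 26880 * (L : ℝ) ^ 4 * (1 / (10 ^ 7 * (L : ℝ) ^ 11))) + (26880 * (L : ℝ) ^ 4) * R) ^ 2 * (18 * (L : ℝ) ^ 4 + 8) ^ 3 / (2 / (10 ^ 22 * (L : ℝ) ^ 33)) ^ 3) / β *
            ((A₀ (s k₀) * (2 * Real.pi ^ 2)⁻¹ ^ Fintype.card ({i : OffIdx L // ¬ i = ⟨(((fun _ => (-1 : ZMod L)), k₀) : Edge 3 L), not_treeEdge_wrap hL k₀⟩} ⊕ ((Fin (2 * L - 1) × Edge 3 L) ⊕ {y : Site 3 L // ¬ y = (0 : Site 3 L)})) / cν (s k₀) /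
            Real.sqrt (LinearMap.det A)) * (2 * Real.pi / β) ^ ((9 : ℝ) * (L : ℝ) ^ 4)) := by
  have hN₀t : su2Quat (centreElem true * N₀) = imQuat ωN ∨ su2Quat (centreElem true * N₀) = -imQuat ωN := by
    right
    rw [show centreElem true = negOne from rfl, T4HaarSU2Translate.su2Quat_mul, su2Quat_negOne, hN₀, neg_one_mul]
  have hN₀f : su2Quat (centreElem false * N₀) = imQuat ωN ∨ su2Quat (centreElem false * N₀) = -imQuat ωN := by
    left
    rw [show centreElem false = (1 : SU2) from rfl, one_mul, hN₀]
  obtain ⟨r₁, D₁, G₁, A₁, c₁, hr₁, hr₁1, hD₁, hG₁, hA₁, hc₁, hmain₁⟩ := fix_htube_final hC hN hCN hX hC₀ hN₀t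
  obtain ⟨r₂, D₂, G₂, A₂, c₂, hr₂, hr₂1, hD₂, hG₂, hA₂, hc₂, hmain₂⟩ := fix_htube_final hC hN hCN hX hC₀ hN₀f
  refine ⟨min r₁ r₂, fun b => cond b D₁ D₂, fun b => cond b G₁ G₂, fun b => cond b A₁ A₂, fun b => cond b c₁ c₂, lt_min hr₁ hr₂,
    (min_le_left _ _).trans_lt hr₁1, fun b => by cases b <;> assumption, fun b => by cases b <;> assumption,
    fun b => by cases b <;> assumption, fun b => by cases b <;> assumption, ?_⟩
  intro L _ hL z hz k₀ hk₀ lam hlamc hlam0 hlamflip hlamstay hNre hCre hNC s Rb hR1 hR2 hR3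
  have hσm : Measurable fun v : EuclideanSpace ℝ (Fin (fixDim L ⟨(((fun _ => (-1 : ZMod L)), k₀) : Edge 3 L), not_treeEdge_wrap hL k₀⟩ 0)) => ringDeficit L z ((Fin.cons (glue (fixSlice ωC ωN ωX C₀ (centreElem (s k₀) * N₀) Rb (fixCoord v)).1) (fixSlice ωC ωN ωX C₀ (centreElem (s k₀) * N₀) Rb (fixCoord v)).2.1 :
              Fin (2 * L - 1 + 1) → GaugeConfig 3 L SU2), (fixSlice ωC ωN ωX C₀ (centreElem (s k₀) * N₀) Rb (fixCoord v)).2.2) :=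
    (measurable_ringDeficit_fix z).comp (measurable_fixSlice_fixCoord ωC ωN ωX C₀ (centreElem (s k₀) * N₀) Rb)
  obtain ⟨A, cc, rr, hAs, hccm, hrrm, hodd, hcc, hrr, hf, hcoer, hupper, hF0⟩ :=
    exists_phase_package_fixCoord' hL z hz hk₀ hlamc hlam0 hlamflip hlamstay hNre hCre hNC hC hN hCN hX hC₀ s hR1 hR2 hR3 hσm
  have hlampos : 0 < (2 / (10 ^ 22 * (L : ℝ) ^ 33)) := by positivity
  have hA₃0 : 0 ≤ (288 * (L : ℝ) ^ 4 * Real.sqrt 2 ^ 3 + 26880 * (L : ℝ) ^ 4 * (1 / (10 ^ 7 * (L : ℝ) ^ 11))) := by positivity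
  have hA₄0 : 0 ≤ (26880 * (L : ℝ) ^ 4) := by positivity
  have hdet : 0 < LinearMap.det A := lt_of_lt_of_le (pow_pos hlampos _) (QuantitativeLaplace.pow_le_det_of_coercive hAs hlampos.le hcoer)
  refine ⟨A, hAs, hcoer, hupper, ?_, fun β R hβ hR hRr hRw hsmall hDR hGR => ?_⟩
  · have h1 := hA₁
    have h2 := hA₂
    have h3 := hc₁
    have h4 := hc₂
    have h5 := Real.sqrt_pos.mpr hdet
    have hc0 : 0 < (2 * Real.pi ^ 2)⁻¹ := by positivity
    cases s k₀ <;> simp only [cond_true, cond_false] <;> positivity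
  have hcc' : ∀ v : EuclideanSpace ℝ (Fin (fixDim L ⟨(((fun _ => (-1 : ZMod L)), k₀) : Edge 3 L), not_treeEdge_wrap hL k₀⟩ 0)), ‖v‖ ≤ R → |cc v| ≤ (288 * (L : ℝ) ^ 4 * Real.sqrt 2 ^ 3 + 26880 * (L : ℝ) ^ 4 * (1 / (10 ^ 7 * (L : ℝ) ^ 11))) * ‖v‖ ^ 3 := fun v hv => hcc v (hv.trans hRw)
  have hrr' : ∀ v : EuclideanSpace ℝ (Fin (fixDim L ⟨(((fun _ => (-1 : ZMod L)), k₀) : Edge 3 L), not_treeEdge_wrap hL k₀⟩ 0)), ‖v‖ ≤ R → |rr v| ≤ (26880 * (L : ℝ) ^ 4) * ‖v‖ ^ 4 := fun v hv => hrr v (hv.trans hRw)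
  have hf' : ∀ v : EuclideanSpace ℝ (Fin (fixDim L ⟨(((fun _ => (-1 : ZMod L)), k₀) : Edge 3 L), not_treeEdge_wrap hL k₀⟩ 0)), ‖v‖ ≤ R →
      ringDeficit L z ((Fin.cons (glue (fixSlice ωC ωN ωX C₀ (centreElem (s k₀) * N₀) Rb (fixCoord v)).1) (fixSlice ωC ωN ωX C₀ (centreElem (s k₀) * N₀) Rb (fixCoord v)).2.1 :
              Fin (2 * L - 1 + 1) → GaugeConfig 3 L SU2), (fixSlice ωC ωN ωX C₀ (centreElem (s k₀) * N₀) Rb (fixCoord v)).2.2) -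
        ringDeficit L z ((Fin.cons (glue (fixSlice ωC ωN ωX C₀ (centreElem (s k₀) * N₀) Rb (fixCoord 0)).1) (fixSlice ωC ωN ωX C₀ (centreElem (s k₀) * N₀) Rb (fixCoord 0)).2.1 :
              Fin (2 * L - 1 + 1) → GaugeConfig 3 L SU2), (fixSlice ωC ωN ωX C₀ (centreElem (s k₀) * N₀) Rb (fixCoord 0)).2.2) = (1 / 2) * ⟪A v, v⟫ + cc v + rr v := fun v hv => hf v (hv.trans hRw)
  clear hf hcc hrr hσm
  generalize hb : s k₀ = b at hF0 hf' hDR hGR ⊢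
  cases b
  · exact (hmain₂ L ⟨(((fun _ => (-1 : ZMod L)), k₀) : Edge 3 L), not_treeEdge_wrap hL k₀⟩ 0 Rb z A (2 / (10 ^ 22 * (L : ℝ) ^ 33)) hAs hlampos hcoer (288 * (L : ℝ) ^ 4 * Real.sqrt 2 ^ 3 + 26880 * (L : ℝ) ^ 4 * (1 / (10 ^ 7 * (L : ℝ) ^ 11))) (26880 * (L : ℝ) ^ 4) β R hA₃0 hA₄0 hβ hR (hRr.trans (min_le_right _ _)) hsmall
      hDR hGR cc rr hccm hrrm hodd hcc' hrr' hf' hF0).2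
  · exact (hmain₁ L ⟨(((fun _ => (-1 : ZMod L)), k₀) : Edge 3 L), not_treeEdge_wrap hL k₀⟩ 0 Rb z A (2 / (10 ^ 22 * (L : ℝ) ^ 33)) hAs hlampos hcoer (288 * (L : ℝ) ^ 4 * Real.sqrt 2 ^ 3 + 26880 * (L : ℝ) ^ 4 * (1 / (10 ^ 7 * (L : ℝ) ^ 11))) (26880 * (L : ℝ) ^ 4) β R hA₃0 hA₄0 hβ hR (hRr.trans (min_le_left _ _)) hsmall
      hDR hGR cc rr hccm hrrm hodd hcc' hrr' hf' hF0).2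


end Summit.QuantumFields.YangMills.Theorems.VirialFluxGap.FixSplit

end
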